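import Summits.QuantumFields.GaugeBoot.EquipartitionBootstrap
import Summits.QuantumFields.GaugeBoot.EquipartitionDLR
import Summits.QuantumFields.GaugeBoot.BootstrapCertificatesSuN
import Summits.QuantumFields.GaugeBoot.BootstrapReducedCertificatesZd
import HarnessLib

/-!
# Gauge-boot: THE EQUIPARTITION BOUND IS CERTIFIED AT LEVEL 4 — explicit SOS ⊕ loop-equation certificates on the torus,
# on `ℤ^d`, and translation-reduced certificates on `ℤ^d` (large-`N` supplement 19, part 9; WHAT REMAINS (lxxxii))

HONEST FRAMING (cell `pub-gaugeboot`, page 1 of every file): certified bounds on lattice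
expectations at STATED coupling, gauge group, dimension and torus size; NOT a mass gap, NOT a
continuum limit, NOT a string tension, NOT large `N`; NOT Yang–Mills-summit-bearing (barriers
`FixedCouplingUltralocality`, `PerturbativeInvisibility`).  Existence of certificates in the lane's certificate format;
no number of CERTIFIED.md is produced.

## Content

Supplements 18 (part 5) and 19 (parts 4–6) proved the equipartition ceiling for every FEASIBLE POINT of the word SDPs at
level `≥ 4`.  By the lane's fixed-level duality (no gap, attainment: `exists_certificate_suN`, `exists_zd_certificate_suN`,
`exists_symCertificate_suN`) a bound valid on all feasible points of a level is CERTIFIED at that level.  Hence, with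
`δ = (N − 1/N)/(4(d−1)β + N − 1/N)` (tree coupling `β ≥ 0`, `N ≥ 2`, `d ≥ 2`) and every `c'` strictly above the ceiling:

* ★★★ `exists_certificate_linkSum_torus` — on every torus of side `L ≥ 2`, at every level `n ≥ 4`:
  `c' • 1 − Σ_{ν≠μ,ε} W(P̃_{ν,ε}) = σ + ρ` with `σ` a non-negative combination of squares of words of length `≤ n` and
  `ρ` a combination of level-`n` loop-equation rows, for every `c' > 2(d−1)(1 − δ)`;
* ★★★ `exists_certificate_linkSum_zd` — the same on the INFINITE lattice for the link plaquette sum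
  `linkPlaquetteSumCM` (rows with the one-link boundary actions);
* ★★★ `exists_symCertificate_planeSum_zd` — for the translation-REDUCED SDP on `ℤ^d`: `c' • 1 − Σ_{ν≠a} u_{x;aν} =
  σ + ρ + τ` with `τ` a combination of translation differences of words of length `≤ 2n`, for every `c' > (d−1)(1 − δ)`.
(Abstract existence from duality; the CONSTRUCTIVE certificate is the one written out in `EquipartitionSOS` /
`PeriodicPlaquetteGradient`: the `(MM)` rows of the `2(d−1)` plaquette words plus `β/8` times the SOS identity.)
[folklore]
-/

noncomputable section

open MeasureTheory Filter Topology NormedSpace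
open scoped Matrix
open Literature.Probability.LatticeModels (Site)
open Literature.MathematicalPhysics.QuantumFieldTheory (LatticeRep GaugeConfig Edge wilsonAction)
open Literature.MathematicalPhysics.QuantumLattice (fundamentalLatticeRep fundamentalRep fundamentalLatticeRep_N LGConfig
  ZdEdge wilsonBoundaryAction)

namespace Summit.QuantumFields.GaugeBoot

namespace EquipartitionZd

/-! ## The torus -/

section Torus

variable {d L N : ℕ}

/-- The link sum of the loop variables of the `2(d−1)` plaquette words through `(x, μ)` is in the level-`n` certificate
domain for `n ≥ 2` (words of length `4 ≤ 2n`). [folklore] -/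
theorem linkSum_mem_certDomainSuN [NeZero L] (β : ℝ) {n : ℕ} (hn : 2 ≤ n)
    (x : Literature.MathematicalPhysics.QuantumFieldTheory.Site d L) (μ : Fin d) :
    (∑ ν ∈ Finset.univ.erase μ, ∑ ε : Bool, wordLoopCM (fundamentalLatticeRep N) x (plaqWord μ ν ε)) ∈
      certDomainSuN (d := d) (L := L) N β n := by
  refine Submodule.sum_mem _ fun ν _ => Submodule.sum_mem _ fun ε _ => ?_
  exact mem_certDomain_of_mem_wordTruncation _
    (wordLoopCM_mem_wordTruncation (fundamentalLatticeRep N) x _ ((length_plaqWord μ ν ε).trans_le (by omega)))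

/-- ★★★ **THE EQUIPARTITION BOUND IS CERTIFIED AT LEVEL 4 ON THE TORUS.**  `N ≥ 2`, `d ≥ 2`, side `L ≥ 2`, tree
coupling `β ≥ 0`, any level `n ≥ 4`, any link `(x, μ)`: for every `c' > 2(d−1)(1 − (N − 1/N)/(4(d−1)β + N − 1/N))`
there are `σ` (a non-negative combination of squares of words of length `≤ n`) and `ρ` (a combination of level-`n`
Schwinger–Dyson rows) with `σ + ρ = c' • 1 − Σ_{ν≠μ,ε} W(P̃_{ν,ε})`. [folklore] -/
theorem exists_certificate_linkSum_torus [NeZero L] (hN : 2 ≤ N) (hd : 2 ≤ d) (hL : (1 : ZMod L) ≠ 0) {β : ℝ}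
    (hβ : 0 ≤ β) {n : ℕ} (hn : 4 ≤ n) (x : Literature.MathematicalPhysics.QuantumFieldTheory.Site d L) (μ : Fin d)
    {c' : ℝ} (hc : 2 * ((d : ℝ) - 1) * (1 - ((N : ℝ) - 1 / N) / (4 * ((d : ℝ) - 1) * β + ((N : ℝ) - 1 / N))) < c') :
    ∃ σ ∈ sosCone (wordTruncation (ι := Edge d L) (fundamentalLatticeRep N) n),
      ∃ ρ ∈ rowSpace (fundamentalLatticeRep N) (suExp N) (fun _ => wilsonAction (fundamentalRep (Fin N)))
        β (wordTruncation (ι := Edge d L) (fundamentalLatticeRep N) n),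
        σ + ρ = c' • (1 : C(GaugeConfig d L (Matrix.specialUnitaryGroup (Fin N) ℂ), ℝ)) -
          ∑ ν ∈ Finset.univ.erase μ, ∑ ε : Bool, wordLoopCM (fundamentalLatticeRep N) x (plaqWord μ ν ε) := by
  refine exists_certificate_suN N β (linkSum_mem_certDomainSuN β (by omega) x μ) (fun t ht => ?_) hc
  obtain ⟨φ, hφ, rfl⟩ := ht
  rw [map_sum]
  simp only [map_sum]
  exact sum_wordLoop_le_of_isBootstrapFeasible_suN hN hn hL hd hβ hφ x μ

end Torus

/-! ## The infinite lattice -/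

section Zd

open TiltedRP (plaquetteZdCM plaquetteZdCM_mem_wordTruncation zdUnit)

variable {d N : ℕ}

/-- The link plaquette sum is in the level-`n` certificate domain of the `ℤ^d` SDP for `n ≥ 2`. [folklore] -/
theorem linkPlaquetteSumCM_mem_certDomainZdSuN (β : ℝ) {n : ℕ} (hn : 2 ≤ n) (x : Site d) (a : Fin d) :
    linkPlaquetteSumCM N x a ∈ certDomainZdSuN (d := d) N β n := by
  refine Submodule.sum_mem _ fun ν _ => Submodule.add_mem _ ?_ ?_
  · exact mem_certDomain_of_mem_wordTruncation _ (plaquetteZdCM_mem_wordTruncation (fundamentalLatticeRep N) (by omega) x a ν)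
  · exact mem_certDomain_of_mem_wordTruncation _
      (plaquetteZdCM_mem_wordTruncation (fundamentalLatticeRep N) (by omega) (x - zdUnit d ν) a ν)

/-- ★★★ **THE EQUIPARTITION BOUND IS CERTIFIED AT LEVEL 4 ON `ℤ^d`.**  `N ≥ 2`, `d ≥ 2`, tree coupling `β ≥ 0`, any
level `n ≥ 4`, any link `(x, a)`: every `c' > 2(d−1)(1 − (N − 1/N)/(4(d−1)β + N − 1/N))` has a level-`n` certificate
`σ + ρ = c' • 1 − Σ_{ν≠a}(u_{x;aν} + u_{x−e_ν;aν})` of the infinite-lattice SDP (one-link boundary actions). [folklore] -/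
theorem exists_certificate_linkSum_zd (hN : 2 ≤ N) (hd : 2 ≤ d) {β : ℝ} (hβ : 0 ≤ β) {n : ℕ} (hn : 4 ≤ n)
    (x : Site d) (a : Fin d) {c' : ℝ} (hc : linkBound d N β < c') :
    ∃ σ ∈ sosCone (wordTruncation (ι := ZdEdge d) (fundamentalLatticeRep N) n),
      ∃ ρ ∈ rowSpace (fundamentalLatticeRep N) (suExp N)
        (fun e => wilsonBoundaryAction (fundamentalRep (Fin N)) {e}) β
        (wordTruncation (ι := ZdEdge d) (fundamentalLatticeRep N) n),
        σ + ρ = c' • (1 : C(LGConfig d (Matrix.specialUnitaryGroup (Fin N) ℂ), ℝ)) - linkPlaquetteSumCM N x a := by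
  refine exists_zd_certificate_suN N β (linkPlaquetteSumCM_mem_certDomainZdSuN β (by omega) x a) (fun φ hφ => ?_) hc
  rw [apply_linkPlaquetteSumCM, linkBound_eq]
  exact TiltedRP.Equipartition.sum_plaquette_le_of_isBootstrapFeasible_zdSuN hN hn hd hβ hφ x a

/-- ★★★ **THE TRANSLATION-REDUCED CERTIFICATE ON `ℤ^d`** ("loops by shape"): `N ≥ 2`, `d ≥ 2`, `β ≥ 0`, `n ≥ 4`:
every `c' > (d−1)(1 − (N − 1/N)/(4(d−1)β + N − 1/N))` has a reduced level-`n` certificate `σ + ρ + τ = c' • 1 −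
Σ_{ν≠a} u_{x;aν}`, `τ` a combination of translation differences of words of length `≤ 2n`. [folklore] -/
theorem exists_symCertificate_planeSum_zd (hN : 2 ≤ N) (hd : 2 ≤ d) {β : ℝ} (hβ : 0 ≤ β) {n : ℕ} (hn : 4 ≤ n)
    (x : Site d) (a : Fin d) {c' : ℝ}
    (hc : ((d : ℝ) - 1) * (1 - ((N : ℝ) - 1 / N) / (4 * ((d : ℝ) - 1) * β + ((N : ℝ) - 1 / N))) < c') :
    ∃ σ ∈ sosCone (wordTruncation (ι := ZdEdge d) (fundamentalLatticeRep N) n),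
      ∃ ρ ∈ rowSpace (fundamentalLatticeRep N) (suExp N)
        (fun e => wilsonBoundaryAction (fundamentalRep (Fin N)) {e}) β
        (wordTruncation (ι := ZdEdge d) (fundamentalLatticeRep N) n),
      ∃ τ ∈ translationDiffZdSuN (d := d) N n,
        σ + ρ + τ = c' • (1 : C(LGConfig d (Matrix.specialUnitaryGroup (Fin N) ℂ), ℝ)) -
          ∑ ν ∈ Finset.univ.erase a, plaquetteZdCM (fundamentalLatticeRep N) x a ν := by
  have hP : (∑ ν ∈ Finset.univ.erase a, plaquetteZdCM (fundamentalLatticeRep N) x a ν) ∈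
      certDomainZdSuN (d := d) N β n :=
    Submodule.sum_mem _ fun ν _ =>
      mem_certDomain_of_mem_wordTruncation _ (plaquetteZdCM_mem_wordTruncation (fundamentalLatticeRep N) (by omega) x a ν)
  exact exists_symCertificate_suN N β hP (fun t ht => symLevelValuesZd_planeSum_le hN hd hβ hn x a ht) hc

end Zd

end EquipartitionZd

end Summit.QuantumFields.GaugeBoot

end
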